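import Mathlib.Tactic
import HarnessLib

/-!
# Kozma–Nitzan's Question 8 at three relays — the KER split (T*) = (K1) + (K2), scalar skeleton

Support file (`--supports stmt-CriticalPhenomena-4575`, closed crux; independent mathematics on Kozma–Nitzan's Question 8,
arXiv:2401.12397 §5.5 p. 36), prover `prim-ineq-gen-6` (gen 15).  No definitions, no named facts, no sorries; standard axioms.
Memo `run/shared/lean/prim/prim-ineq-gen-6/FINDING-G15.md` §4, §6.  Companion of `…KnQuestion8ClaimMReduction.lean`
(`PocketCert.tstar_of_claimM_abstract`, `tstar_of_split_abstract`), whose hypotheses CLAIM(M) / (SPLIT) turned out to be false in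
rare instances; the two hypotheses (K1), (K2) below have 0 exact negatives in the exhaustive census n ≤ 5 (all connected edge sets ×
all ordered `(x,o,v)`, palettes `{½}`, `{⅓,⅔}^m`, `40 × {.1,.5,.9}^m`; kit j101553/j101554/j101555, 3 868 440 instances) and in 900
random/extreme instances with `|Y| ≤ 2`.
**CORRECTION (same day, kit j101556 — random graphs n ≤ 8 with extreme weights + weight/structure hill-climbing, exact recheck):
(K1) and (K2) are each FALSE in rare instances (18 resp. 11 exact negatives in 64 960, worst −0.029 resp. −7.3e−6; (T*) itself has 0
negatives there): e.g. (K1) fails for n = 6, Y = ∅, edges (0,3)½ (1,4).52 (0,4)½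
(2,4).99 (2,3).9672 (0,2).1 (3,5).01, x=5, o=2, v=1 (K1 = −0.02188; (K2) and (T*) are not violated in that instance).  So the two theorems below are correct reductions
whose hypotheses are NOT valid laws — exactly like `tstar_of_claimM_abstract` / `tstar_of_split_abstract`; memo FINDING-G15 §6.**

Setting (frame `ν' = μ(· | {x,o} ↮ Y)`, `U = V(C_x ∪ C_o)`, `h` an increasing function of `U`, `V_K := {v ~ x in G − o}` = "`v` is
joined to `x` NOT through `o`"): the frame splits into the six atoms
`OVK = {o~x} ∩ V_K`, `OV' = {o~x, v~x only through o}`, `OM = {o~x, v≁x}`, `E = {o~v, o≁x}`, `PV = {o≁x, o≁v, v~x}` (`⊆ V_K`),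
`PM = {x, o, v pairwise separated}`; `mA` is the mass of atom `A`, `gA = ∫_A h(U)`, `F = Σ mA`, `P = mPV + mPM`, `a = mOVK + mOV' + mOM`.
The (T*) functional of the cell (memo FINDING-TSTAR-g12 of prim-ineq-gen-7; = (UPZ)/(DOM) of prim-ineq-gen-6 for the U-class) is
  `star := mPM·(P·gO − a·gP) − mE·(mPM·gP − P·gPM)`,  `gO = gOVK + gOV' + gOM`, `gP = gPV + gPM`.
* `PocketCert.star_eq_kerSplit` — the IDENTITY `star = P·K1' + K2'` with
    `K1' := mPM·(gOM + gOV') − (mOM + mOV')·gPM`     ((K1): `law(U | o~x, x≁v off o) ≽ law(U | PM)`, mass-normalised),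
    `K2' := mPM·(P·(gOVK + gPV) − F·gPV) − (P·(mOVK + mPV) − F·mPV)·gPM`
          ((K2): `π'·E'[h; V_K] − E'[h; PV] ≥ (π'ν'(V_K) − π'_V)·E'[h | PM]`; the left side is `≥ 0` by Harris/BHK for
          `Cov'(h(U)·1_{V_K}, 1_{O2}) ≥ 0`, memo §6 (ε_K)).
  It is the o-edges-last bookkeeping of the memo (§4): `U` never depends on the edges between `o` and `C_x^{G−o}`.
* `PocketCert.tstar_of_K1_K2_abstract` — **(T*) from (K1) and (K2)**: `0 ≤ K1'`, `0 ≤ K2'`, masses `≥ 0` ⟹ `0 ≤ star`.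
So KN Question 8 at `|A| = 3` (centring side) is reduced, in the tree, to the two domination statements (K1), (K2), each comparing ONE
object with the bottom law `law(U | PM)`.
[cite: KozmaNitzan2024, Question 8 (§5.5 p. 36)] [cite: VandenbergHaggstromKahn2005, Thm. 2.1 (p. 9)]
-/

namespace Summit.CriticalPhenomena.PercolationContinuityZ3.Theorems

namespace PocketCert

/-- **The KER identity** `star = P·K1' + K2'` (pure ring identity; dictionary in the module docstring).
[cite: KozmaNitzan2024, Question 8 (§5.5 p. 36)] -/
theorem star_eq_kerSplit (mOVK mOVp mOM mE mPV mPM gOVK gOVp gOM gPV gPM : ℝ) :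
    mPM * ((mPV + mPM) * (gOVK + gOVp + gOM) - (mOVK + mOVp + mOM) * (gPV + gPM)) -
        mE * (mPM * (gPV + gPM) - (mPV + mPM) * gPM) =
      (mPV + mPM) * (mPM * (gOM + gOVp) - (mOM + mOVp) * gPM) +
        (mPM * ((mPV + mPM) * (gOVK + gPV) - (mOVK + mOVp + mOM + mE + mPV + mPM) * gPV) -
          ((mPV + mPM) * (mOVK + mPV) - (mOVK + mOVp + mOM + mE + mPV + mPM) * mPV) * gPM) := by
  ring

/-- **(T*) ⟸ (K1) ∧ (K2)**, scalar form: with nonnegative masses, `0 ≤ K1'` and `0 ≤ K2'` give `0 ≤ star`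
(see the module docstring; `star` is literally the conclusion of `PocketCert.tstar_of_claimM_abstract` with `mOV = mOVK + mOV'`,
`gOV = gOVK + gOV'`).
[cite: KozmaNitzan2024, Question 8 (§5.5 p. 36)] -/
theorem tstar_of_K1_K2_abstract (mOVK mOVp mOM mE mPV mPM gOVK gOVp gOM gPV gPM : ℝ)
    (hPV : 0 ≤ mPV) (hPM : 0 ≤ mPM)
    (hK1 : (mOM + mOVp) * gPM ≤ mPM * (gOM + gOVp))
    (hK2 : ((mPV + mPM) * (mOVK + mPV) - (mOVK + mOVp + mOM + mE + mPV + mPM) * mPV) * gPM ≤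
      mPM * ((mPV + mPM) * (gOVK + gPV) - (mOVK + mOVp + mOM + mE + mPV + mPM) * gPV)) :
    0 ≤ mPM * ((mPV + mPM) * (gOVK + gOVp + gOM) - (mOVK + mOVp + mOM) * (gPV + gPM)) -
        mE * (mPM * (gPV + gPM) - (mPV + mPM) * gPM) := by
  rw [star_eq_kerSplit]
  have h1 : 0 ≤ (mPV + mPM) * (mPM * (gOM + gOVp) - (mOM + mOVp) * gPM) :=
    mul_nonneg (by linarith) (by linarith)
  linarith

end PocketCert

end Summit.CriticalPhenomena.PercolationContinuityZ3.Theorems
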